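import Mathlib
import Literature.NumberTheory.LFunctions.Zhang2022.Section7SjPolylog
import Literature.NumberTheory.LFunctions.Zhang2022.SkeletonPartTwo
import Literature.NumberTheory.Sieve.ShiuUniform
import Literature.NumberTheory.Sieve.DivisorPowerSums
import Literature.NumberTheory.LFunctions.MertensElementary
import HarnessLib

/-!
# Zhang (2022) §11 p. 64: a hybrid majorant of `ξ₀ⱼ(n;d,r)` with log-mean exponent `3` on the full
# range `n ≤ P`, and its short-window sums (Shiu)

Topic `Literature/NumberTheory/LFunctions/Zhang2022` (Landau–Siegel audit tree; verdict-neutral).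
Y. Zhang, *Discrete mean estimates and the Landau–Siegel zero*, arXiv:2211.02515v1 (2022)
[Zhang2022LandauSiegel], §11 p. 64 (tex L3298–L3301): "By (11.3), (8.25) and (8.26),
`Σ_{ψ∈Ψ₁}Σ_{ρ} 𝔠*(ρ,ψ)|Σ_{n∈𝔍₁} χψ(n)n^{−ρ}(f̃(log n/log P) − g̃₁(n))|²ω(ρ) = o(𝔞𝔓)`" — **an
unrefereed manuscript under adjudication; nothing here asserts or denies its Theorems 1–2.** The
displays "(8.25), (8.26)" do not exist in v1 (cell `siegel-zhang`, GAP row `G-L3t10-1`, typed leaf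
`Typed.TypedSection11B.Step11u019`). The in-cone route (companion files `Section11WindowSj`,
`Section11WindowMeanSquare`) is Lemma 8.1 + Proposition 7.1 + a bound for the arithmetic sums
`S_j(𝐛,𝐛̄)` of Prop. 7.1 for sequences supported on the three windows `𝔍₁` with `|b| ≪ 𝓛⁻¹⁰`.
The window bound needs the `n`-sums `Σ_{X<n<Xη²} |ξ₀ⱼ(n;d,r)|/n` (`η² = e^{2𝓛⁻¹⁰}`) at their true
size `≪ 𝓛⁻¹⁰(log X)²` (not the full logarithmic mean `(log X)³`). THIS FILE supplies:

* `LamH`, `gH` — the HYBRID multiplicative majorant `gH = Λ_H·(w ∗ Kmaj) ≥ |ξ₀ⱼ(·;d,r)|` (all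
  `n ≥ 1`, uniformly in `d, r, j`): at a prime `q` the `λ`-factor is the sharp `1 + 10B log q` of
  `Section8XiZeroTailMean` when `B log q ≤ 1/8` and the crude `1 + 12/q` of `Section7SjPolylog`
  otherwise, so that `gH(p) ≤ 3 + K·B log p + M/p` for EVERY prime (`B = |b₁|+|b₂|+|b₃| ≤ 9π𝓛⁻⁹`,
  hence `K·B log p ≪ 1` up to `p ≤ P`) and `gH(p^ν) ≤ 7(2+S₃)(ν+1)⁴`;
* `exists_rpow_majorant_of_prime_pow_le` — a multiplicative `f ≥ 0` with `f(p^ν) ≤ c(ν+1)^k` has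
  `f(n) ≤ A₂(δ)n^δ` with `A₂` depending only on `c, k` (divisor bound), the shape Shiu's theorem wants;
* the short-window sums `Σ_{X<n≤Xη²} gH(n)/n ≪ 𝓛⁸` (Shiu) are in the companion file
  `Section11WindowShiu`.

0 new facts; standard axioms.

## References

* Y. Zhang, arXiv:2211.02515v1 (2022), §11 p. 64; §7 p. 33 (the objects `λ₀ⱼ`, `ξ₀ⱼ`).
  [cite: Zhang2022LandauSiegel, §11 p. 64; §7 p. 33]
* P. Shiu, J. reine angew. Math. 313 (1980), 161–170, Theorem 1. [cite: Shiu1980, Theorem 1]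
* R. R. Hall, G. Tenenbaum, *Divisors* (CUP 1988), (0.4). [cite: HallTenenbaum1988, (0.4)]
-/

noncomputable section

open Finset Real ArithmeticFunction

namespace Literature.NumberTheory.LFunctions.Zhang2022.XiZeroMajorant

open MeanSquareMajorant

variable (c' : ℝ) (D : ℕ)

/-! ### Part 1. The hybrid `λ`-majorant `Λ_H` -/

/-- The hybrid Euler factor: `1 + 10B log q` if `B log q ≤ 1/8`, else `1 + 12/q`.
[cite: Zhang2022LandauSiegel, §7 p.33] -/
def lamHfac (q : ℕ) : ℝ :=
  if Bsum c' D * Real.log q ≤ 1 / 8 then 1 + 10 * (Bsum c' D * Real.log q) else 1 + 12 / (q : ℝ)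

/-- `Λ_H(n) = ∏_{q∣n} lamHfac q` (`0 ↦ 0`). [cite: Zhang2022LandauSiegel, §7 p.33] -/
def LamH : ArithmeticFunction ℝ :=
  ⟨fun n => if n = 0 then 0 else ∏ q ∈ n.primeFactors, lamHfac c' D q, if_pos rfl⟩

/-- `Λ_H(n)` for `n ≠ 0`. [cite: Zhang2022LandauSiegel, §7 p.33] -/
theorem LamH_apply {n : ℕ} (hn : n ≠ 0) : LamH c' D n = ∏ q ∈ n.primeFactors, lamHfac c' D q := by
  rw [LamH]; exact if_neg hn

/-- Each hybrid factor is `≥ 1` at a prime. [cite: Zhang2022LandauSiegel, §7 p.33] -/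
theorem one_le_lamHfac {q : ℕ} (hq : q.Prime) : 1 ≤ lamHfac c' D q := by
  unfold lamHfac
  split_ifs
  · exact one_le_LamA_factor c' D hq
  · exact one_le_LamC_factor q

/-- Each hybrid factor is `≤ 7` at a prime (`1 + 10/8` resp. `1 + 12/2`).
[cite: Zhang2022LandauSiegel, §7 p.33] -/
theorem lamHfac_le_seven {q : ℕ} (hq : q.Prime) : lamHfac c' D q ≤ 7 := by
  unfold lamHfac
  split_ifs with h
  · linarith
  · have hq2 : (2 : ℝ) ≤ q := by exact_mod_cast hq.two_le
    have : 12 / (q : ℝ) ≤ 6 := by rw [div_le_iff₀ (by linarith)]; linarith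
    linarith

/-- `Λ_H` is multiplicative. [cite: Zhang2022LandauSiegel, §7 p.33] -/
theorem isMultiplicative_LamH : (LamH c' D).IsMultiplicative := by
  rw [IsMultiplicative.iff_ne_zero]
  refine ⟨by simp [LamH], fun {m n} hm hn hmn => ?_⟩
  rw [LamH_apply c' D (mul_ne_zero hm hn), LamH_apply c' D hm, LamH_apply c' D hn,
    Nat.primeFactors_mul hm hn, prod_union (Nat.Coprime.disjoint_primeFactors hmn)]

/-- `0 ≤ Λ_H(n)`. [cite: Zhang2022LandauSiegel, §7 p.33] -/
theorem LamH_nonneg (n : ℕ) : 0 ≤ LamH c' D n := by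
  rcases eq_or_ne n 0 with rfl | hn
  · simp [LamH]
  · rw [LamH_apply c' D hn]
    exact prod_nonneg fun q hq => by
      linarith [one_le_lamHfac c' D (Nat.prime_of_mem_primeFactors hq)]

/-- `Λ_H(p^ν) ≤ 7` (`= lamHfac p` for `ν ≥ 1`, `= 1` for `ν = 0`). [cite: Zhang2022LandauSiegel, §7 p.33] -/
theorem LamH_prime_pow_le {p : ℕ} (hp : p.Prime) (ν : ℕ) : LamH c' D (p ^ ν) ≤ 7 := by
  rcases Nat.eq_zero_or_pos ν with rfl | hν
  · rw [pow_zero, (isMultiplicative_LamH c' D).map_one]; norm_num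
  · rw [LamH_apply c' D (pow_ne_zero ν hp.ne_zero), Nat.primeFactors_prime_pow hν.ne' hp,
      prod_singleton]
    exact lamHfac_le_seven c' D hp

/-- **`|λ₀ⱼ(q)| ≤ lamHfac q`** at every prime `q` (sharp bound when `B log q ≤ 1/8`, crude bound
otherwise). [cite: Zhang2022LandauSiegel, §7 p.33] -/
theorem norm_lamZero_le_lamHfac {q : ℕ} (hq : q.Prime) (j : ℕ) :
    ‖Skeleton.lamZero c' D j q‖ ≤ lamHfac c' D q := by
  unfold lamHfac
  split_ifs with h
  · exact norm_lamZero_le c' D hq j h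
  · have h2 := norm_lamZero_le_LamC c' D hq.ne_zero j
    rwa [LamC_apply hq.ne_zero, hq.primeFactors, prod_singleton] at h2

/-- **`|λ̃₀ⱼ(n,dr)| ≤ Λ_H(n)`** for every `n ≠ 0` (any `j, dr`). [cite: Zhang2022LandauSiegel, §7 p.33] -/
theorem norm_lamTildeZero_le_LamH {n : ℕ} (hn : n ≠ 0) (j dr : ℕ) :
    ‖Skeleton.lamTildeZero c' D j n dr‖ ≤ LamH c' D n := by
  classical
  have hS : n.primeFactors.filter (fun q => Nat.Coprime q dr) ⊆ n.primeFactors :=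
    filter_subset _ _
  rw [Skeleton.lamTildeZero, norm_prod, LamH_apply c' D hn, ← prod_sdiff hS]
  set S := n.primeFactors.filter (fun q => Nat.Coprime q dr) with hSdef
  have h1 : ∏ q ∈ S, ‖Skeleton.lamZero c' D j q‖ ≤ ∏ q ∈ S, lamHfac c' D q :=
    prod_le_prod (fun q _ => norm_nonneg _) fun q hq =>
      norm_lamZero_le_lamHfac c' D (Nat.prime_of_mem_primeFactors (hS hq)) j
  have hge1 : (1 : ℝ) ≤ ∏ q ∈ (n.primeFactors \ S), lamHfac c' D q := by
    calc (1 : ℝ) = ∏ q ∈ (n.primeFactors \ S), (1 : ℝ) := by simp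
      _ ≤ _ := prod_le_prod (fun _ _ => zero_le_one) fun q hq =>
          one_le_lamHfac c' D (Nat.prime_of_mem_primeFactors (mem_sdiff.mp hq).1)
  have hnn : 0 ≤ ∏ q ∈ S, lamHfac c' D q :=
    prod_nonneg fun q hq => by
      linarith [one_le_lamHfac c' D (Nat.prime_of_mem_primeFactors (hS hq))]
  exact h1.trans (le_mul_of_one_le_left hnn hge1)

/-! ### Part 2. The hybrid majorant `gH = Λ_H · (w ∗ Kmaj)` of `ξ₀ⱼ` -/

/-- **The hybrid majorant `gH = Λ_H · (w ∗ Kmaj)`** of `|ξ₀ⱼ(·;d,r)|` (independent of `d, r, j`).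
[cite: Zhang2022LandauSiegel, §7 p.33] -/
def gH : ArithmeticFunction ℝ := (LamH c' D).pmul (Wt * KA c' D)

/-- `gH` is multiplicative. [cite: Zhang2022LandauSiegel, §7 p.33] -/
theorem isMultiplicative_gH : (gH c' D).IsMultiplicative :=
  (isMultiplicative_LamH c' D).pmul (isMultiplicative_Wt.mul (isMultiplicative_KA c' D))

/-- `0 ≤ gH(n)`. [cite: Zhang2022LandauSiegel, §7 p.33] -/
theorem gH_nonneg (n : ℕ) : 0 ≤ gH c' D n := by
  rw [gH, pmul_apply]; exact mul_nonneg (LamH_nonneg c' D n) (WK_nonneg c' D n)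

/-- **`|ξ₀ⱼ(n;d,r)| ≤ gH(n)`** for every `n ≠ 0` (any `j, d, r`; no hypothesis on `D`).
[cite: Zhang2022LandauSiegel, §7 p.33] -/
theorem norm_xiZero_le_gH {n : ℕ} (hn : n ≠ 0) (j d r : ℕ) :
    ‖Skeleton.xiZero c' D j n d r‖ ≤ gH c' D n := by
  rw [Skeleton.xiZero, norm_mul, gH, pmul_apply, WK_apply]
  refine mul_le_mul (norm_lamTildeZero_le_LamH c' D hn j (d * r)) ?_ (norm_nonneg _)
    (LamH_nonneg c' D n)
  calc ‖∑ k ∈ n.divisors.filter (fun k => Nat.Coprime k r),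
          Skeleton.kappaTildeZero c' D j (n / k) (d * r * k) * (ArithmeticFunction.moebius k : ℂ) *
            (k : ℂ) ^ (1 - Skeleton.betaJ c' D j) / (Nat.totient k : ℂ)‖
      ≤ ∑ k ∈ n.divisors.filter (fun k => Nat.Coprime k r),
          ‖Skeleton.kappaTildeZero c' D j (n / k) (d * r * k) * (ArithmeticFunction.moebius k : ℂ) *
            (k : ℂ) ^ (1 - Skeleton.betaJ c' D j) / (Nat.totient k : ℂ)‖ := norm_sum_le _ _
    _ ≤ ∑ k ∈ n.divisors.filter (fun k => Nat.Coprime k r), Wt k * KA c' D (n / k) :=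
        sum_le_sum fun k hk => norm_xiZero_term_le c' D hn j d r (mem_filter.mp hk).1
    _ ≤ ∑ k ∈ n.divisors, Wt k * KA c' D (n / k) :=
        sum_le_sum_of_subset_of_nonneg (filter_subset _ _)
          fun k _ _ => mul_nonneg (Wt_nonneg k) (KA_nonneg c' D _)

/-- The `log p` coefficient of the prime bound for `gH` (times `B`): `129/4 + 5M₀ + 16`.
[cite: Zhang2022LandauSiegel, §7 p.33] -/
def KH : ℝ := 129 / 4 + 5 * M0 + 16

/-- The `1/p` coefficient of the prime bound for `gH`: `60 + 7M₀`. [cite: Zhang2022LandauSiegel, §7 p.33] -/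
def MH : ℝ := 60 + 7 * M0

/-- `0 ≤ KH`. [cite: Zhang2022LandauSiegel, §7 p.33] -/
theorem KH_nonneg : 0 ≤ KH := by unfold KH; linarith [M0_nonneg]

/-- `0 ≤ MH`. [cite: Zhang2022LandauSiegel, §7 p.33] -/
theorem MH_nonneg : 0 ≤ MH := by unfold MH; linarith [M0_nonneg]

/-- **`gH(p) ≤ 3 + KH·(B log p) + MH/p` at EVERY prime**: for `B log p ≤ 1/8` this is the sharp
bound of `gMaj` (`gH(p) = gMaj(p)` there); otherwise `gH(p) = gC(p) ≤ 5 + MH/p` and `2 < 16·B log p`.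
[cite: Zhang2022LandauSiegel, §7 p.33] -/
theorem gH_prime_le {p : ℕ} (hp : p.Prime) :
    gH c' D p ≤ 3 + KH * (Bsum c' D * Real.log p) + MH / p := by
  have hp2 : (2 : ℝ) ≤ p := by exact_mod_cast hp.two_le
  have hppos : (0 : ℝ) < p := by linarith
  have hlog : 0 ≤ Real.log p := Real.log_nonneg (by linarith)
  have hB0 := Bsum_nonneg c' D
  have hε0 : 0 ≤ Bsum c' D * Real.log p := mul_nonneg hB0 hlog
  have hM0 := M0_nonneg
  have hWK0 : 0 ≤ (Wt * KA c' D) p := WK_nonneg c' D p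
  have hLamH : LamH c' D p = lamHfac c' D p := by
    rw [LamH_apply c' D hp.ne_zero, hp.primeFactors, prod_singleton]
  rw [gH, pmul_apply, hLamH]
  by_cases h : Bsum c' D * Real.log p ≤ 1 / 8
  · -- sharp case: `gH p = gMaj p`
    have hfac : lamHfac c' D p = LamA c' D p := by
      rw [lamHfac, if_pos h, LamA_apply c' D hp.ne_zero, hp.primeFactors, prod_singleton]
    have hg := gMaj_prime_le c' D hp h
    rw [gMaj, pmul_apply] at hg
    rw [hfac]
    have h16 : 0 ≤ 16 * (Bsum c' D * Real.log p) := by positivity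
    have hMp : M0 / p ≤ MH / p := div_le_div_of_nonneg_right (by unfold MH; linarith) hppos.le
    calc LamA c' D p * (Wt * KA c' D) p
        ≤ 3 + (129 / 4 + 5 * M0) * (Bsum c' D * Real.log p) + M0 / p := hg
      _ ≤ 3 + KH * (Bsum c' D * Real.log p) + MH / p := by
          unfold KH; nlinarith
  · -- crude case: `gH p = gC p ≤ 5 + MH/p`, and `1/8 < B log p`
    have hfac : lamHfac c' D p = LamC p := by
      rw [lamHfac, if_neg h, LamC_apply hp.ne_zero, hp.primeFactors, prod_singleton]
    have hg := gC_prime_le c' D hp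
    rw [gC, pmul_apply] at hg
    rw [hfac]
    have hlt : 1 / 8 < Bsum c' D * Real.log p := lt_of_not_ge h
    have hK16 : 16 ≤ KH := by unfold KH; linarith
    calc LamC p * (Wt * KA c' D) p ≤ 5 + (60 + 7 * M0) / p := hg
      _ = 5 + MH / p := by rw [MH]
      _ ≤ 3 + 16 * (Bsum c' D * Real.log p) + MH / p := by linarith
      _ ≤ 3 + KH * (Bsum c' D * Real.log p) + MH / p := by nlinarith

/-- The prime-power constant `CH = 7(2 + S₃)`. [cite: Zhang2022LandauSiegel, §7 p.33] -/
def CH : ℝ := 7 * (2 + LogEulerProduct.tailConst 3)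

/-- `1 ≤ CH`. [cite: Zhang2022LandauSiegel, §7 p.33] -/
theorem one_le_CH : 1 ≤ CH := by
  unfold CH; linarith [LogEulerProduct.tailConst_nonneg 3]

/-- `gH(p^ν) ≤ CH·(ν+1)⁴` at prime powers. [cite: Zhang2022LandauSiegel, §7 p.33] -/
theorem gH_prime_pow_le {p : ℕ} (hp : p.Prime) (ν : ℕ) :
    gH c' D (p ^ ν) ≤ CH * ((ν : ℝ) + 1) ^ 4 := by
  rw [gH, pmul_apply, CH]
  calc LamH c' D (p ^ ν) * (Wt * KA c' D) (p ^ ν)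
      ≤ 7 * ((2 + LogEulerProduct.tailConst 3) * ((ν : ℝ) + 1) ^ 4) :=
        mul_le_mul (LamH_prime_pow_le c' D hp ν) (WK_prime_pow_le c' D hp ν) (WK_nonneg c' D _)
          (by norm_num)
    _ = _ := by ring

/-- The local series of `gH` converges at every prime. [cite: Zhang2022LandauSiegel, §7 p.33] -/
theorem summable_gH_local {p : ℕ} (hp : p.Prime) :
    Summable fun ν : ℕ => gH c' D (p ^ ν) / (p : ℝ) ^ ν := by
  have hC := one_le_CH
  have hp2 : (2 : ℝ) ≤ p := by exact_mod_cast hp.two_le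
  have hbound : ∀ ν : ℕ, gH c' D (p ^ ν) / (p : ℝ) ^ ν ≤
      CH * (((ν : ℝ) + 3) ^ 4 * (1 / 2 : ℝ) ^ ν) := by
    intro ν
    have hppos : (0 : ℝ) < (p : ℝ) ^ ν := by positivity
    rw [div_le_iff₀ hppos]
    have h1 : (1 : ℝ) ≤ (1 / 2 : ℝ) ^ ν * (p : ℝ) ^ ν := by
      rw [← mul_pow]; exact one_le_pow₀ (by linarith)
    have h3 : ((ν : ℝ) + 1) ^ 4 ≤ ((ν : ℝ) + 3) ^ 4 :=
      pow_le_pow_left₀ (by positivity) (by linarith) 4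
    calc gH c' D (p ^ ν) ≤ CH * ((ν : ℝ) + 1) ^ 4 := gH_prime_pow_le c' D hp ν
      _ ≤ CH * ((ν : ℝ) + 3) ^ 4 := by gcongr
      _ ≤ CH * ((ν : ℝ) + 3) ^ 4 * ((1 / 2 : ℝ) ^ ν * (p : ℝ) ^ ν) :=
          le_mul_of_one_le_right (by positivity) h1
      _ = _ := by ring
  exact Summable.of_nonneg_of_le (fun ν => div_nonneg (gH_nonneg c' D _) (by positivity))
    hbound ((LogEulerProduct.summable_tailConst 4).mul_left _)

/-- **The full logarithmic mean of `gH`** (valid for every `X ≥ 2`):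
`Σ_{n≤X} gH(n)/n ≤ exp(12 + KH·B·log(4X) + MH + CH·S₄)·(log X)³`.
[cite: HallTenenbaum1988, (0.4)] -/
theorem sum_gH_div_le {X : ℕ} (hX : 2 ≤ X) :
    ∑ n ∈ Icc 1 X, gH c' D n / n ≤
      Real.exp (4 * (3 : ℕ) + KH * Bsum c' D * Real.log (4 * X) + MH +
        CH * LogEulerProduct.tailConst 4) * Real.log X ^ (3 : ℕ) := by
  have hg := isMultiplicative_gH c' D
  refine sum_div_le_gen (f := fun n => gH c' D n) hg.map_one
    (fun m n hmn => hg.map_mul_of_coprime hmn) (gH_nonneg c' D)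
    (mul_nonneg KH_nonneg (Bsum_nonneg c' D)) MH_nonneg (le_trans zero_le_one one_le_CH) hX
    (fun p hp => summable_gH_local c' D hp) (fun p hp _ => ?_) (fun p ν hp _ => ?_)
  · have h := gH_prime_le c' D hp
    push_cast
    linarith [h]
  · exact gH_prime_pow_le c' D hp ν

/-! ### Part 3. A divisor-type bound `f(n) ≤ A₂(δ)n^δ` from `f(p^ν) ≤ c(ν+1)^k` -/

omit c' D in
/-- A nonnegative multiplicative `f` with `f(p^ν) ≤ c(ν+1)^k` at prime powers satisfies
`f(n) ≤ τ(n)^K` for `n ≥ 1`, with `K = ⌈c⌉₊ + k` (`c ≤ ⌈c⌉₊ < 2^{⌈c⌉₊} ≤ (ν+1)^{⌈c⌉₊}`).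
[cite: HardyWright2008, Theorem 315] -/
theorem le_sigma_zero_pow_of_prime_pow_le {f : ℕ → ℝ} {c : ℝ} {k : ℕ} (hf0 : ∀ n, 0 ≤ f n)
    (hmul : ∀ m n : ℕ, m.Coprime n → f (m * n) = f m * f n)
    (hpp : ∀ p ν : ℕ, p.Prime → 1 ≤ ν → f (p ^ ν) ≤ c * ((ν : ℝ) + 1) ^ k) {n : ℕ} (hn : n ≠ 0) :
    f n ≤ ((ArithmeticFunction.sigma 0 n : ℕ) : ℝ) ^ (⌈c⌉₊ + k) := by
  induction n using Nat.recOnPosPrimePosCoprime with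
  | prime_pow p ν hp hν =>
    rw [ArithmeticFunction.sigma_zero_apply_prime_pow hp]
    push_cast
    have h2 : (2 : ℝ) ≤ (ν : ℝ) + 1 := by
      have : (1 : ℝ) ≤ ν := by exact_mod_cast hν
      linarith
    have hc : c ≤ ((ν : ℝ) + 1) ^ ⌈c⌉₊ :=
      calc c ≤ (⌈c⌉₊ : ℝ) := Nat.le_ceil c
        _ ≤ (2 : ℝ) ^ ⌈c⌉₊ := by exact_mod_cast (Nat.lt_two_pow_self (n := ⌈c⌉₊)).le
        _ ≤ ((ν : ℝ) + 1) ^ ⌈c⌉₊ := pow_le_pow_left₀ (by norm_num) h2 _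
    calc f (p ^ ν) ≤ c * ((ν : ℝ) + 1) ^ k := hpp p ν hp hν
      _ ≤ ((ν : ℝ) + 1) ^ ⌈c⌉₊ * ((ν : ℝ) + 1) ^ k :=
          mul_le_mul_of_nonneg_right hc (by positivity)
      _ = ((ν : ℝ) + 1) ^ (⌈c⌉₊ + k) := by rw [pow_add]
  | zero => exact absurd rfl hn
  | one =>
    have h11 : f 1 = f 1 * f 1 := by
      have := hmul 1 1 (Nat.coprime_one_left 1); rwa [mul_one] at this
    have hf1 : f 1 ≤ 1 := by
      by_contra hlt
      push Not at hlt
      have : f 1 * 1 < f 1 * f 1 := mul_lt_mul_of_pos_left hlt (by linarith)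
      linarith
    simpa using hf1
  | coprime a b ha hb hab iha ihb =>
    have ha0 : a ≠ 0 := by omega
    have hb0 : b ≠ 0 := by omega
    rw [hmul a b hab, ArithmeticFunction.isMultiplicative_sigma.map_mul_of_coprime hab,
      Nat.cast_mul, mul_pow]
    exact mul_le_mul (iha ha0) (ihb hb0) (hf0 b) (pow_nonneg (Nat.cast_nonneg _) _)

omit c' D in
/-- **Divisor-type majorant, uniform in the function**: for `c, k` there is `A₂ : ℝ → ℝ` such that
every nonnegative multiplicative `f` with `f(p^ν) ≤ c(ν+1)^k` (`ν ≥ 1`) satisfies `f(n) ≤ A₂(δ)n^δ`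
for all `δ > 0`, `n ≥ 1` (`f ≤ τ^K` and the divisor bound `τ(n) ≪_ε n^ε`). This is hypothesis (ii)
of Shiu's theorem with a constant independent of `f`. [cite: HardyWright2008, Theorem 315] -/
theorem exists_rpow_majorant_of_prime_pow_le (c : ℝ) (k : ℕ) :
    ∃ A₂ : ℝ → ℝ, ∀ f : ℕ → ℝ, (∀ n, 0 ≤ f n) →
      (∀ m n : ℕ, m.Coprime n → f (m * n) = f m * f n) →
      (∀ p ν : ℕ, p.Prime → 1 ≤ ν → f (p ^ ν) ≤ c * ((ν : ℝ) + 1) ^ k) →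
      ∀ δ : ℝ, 0 < δ → ∀ n : ℕ, 1 ≤ n → f n ≤ A₂ δ * (n : ℝ) ^ δ := by
  classical
  set K : ℕ := ⌈c⌉₊ + k + 1 with hK
  have hKpos : (0 : ℝ) < K := by rw [hK]; positivity
  set A₂ : ℝ → ℝ := fun δ =>
    if h : 0 < δ then
      (Classical.choose (Literature.NumberTheory.Sieve.exists_sigma_zero_le_mul_rpow
        (div_pos h hKpos))) ^ K
    else 1 with hA₂
  refine ⟨A₂, fun f hf0 hmul hpp δ hδ n hn => ?_⟩
  have hn0 : n ≠ 0 := by omega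
  simp only [hA₂, dif_pos hδ]
  set Cδ := Classical.choose (Literature.NumberTheory.Sieve.exists_sigma_zero_le_mul_rpow
    (div_pos hδ hKpos))
  obtain ⟨hC1, hCn⟩ := Classical.choose_spec
    (Literature.NumberTheory.Sieve.exists_sigma_zero_le_mul_rpow (div_pos hδ hKpos))
  have hτ1 : (1 : ℝ) ≤ ((ArithmeticFunction.sigma 0 n : ℕ) : ℝ) := by
    exact_mod_cast Literature.NumberTheory.Sieve.one_le_sigma_zero hn0
  have hnn : (0 : ℝ) ≤ n := Nat.cast_nonneg n
  calc f n ≤ ((ArithmeticFunction.sigma 0 n : ℕ) : ℝ) ^ (⌈c⌉₊ + k) :=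
        le_sigma_zero_pow_of_prime_pow_le hf0 hmul hpp hn0
    _ ≤ ((ArithmeticFunction.sigma 0 n : ℕ) : ℝ) ^ K := pow_le_pow_right₀ hτ1 (by omega)
    _ ≤ (Cδ * (n : ℝ) ^ (δ / K)) ^ K := pow_le_pow_left₀ (Nat.cast_nonneg _) (hCn n) K
    _ = Cδ ^ K * (n : ℝ) ^ δ := by
        rw [mul_pow, ← Real.rpow_natCast ((n : ℝ) ^ (δ / K)) K, ← Real.rpow_mul hnn]
        congr 2
        field_simp

omit D in
/-- `gH(p^l) ≤ (16·CH)^l` for `l ≥ 1` (`(l+1)⁴ ≤ 16^l`, `CH ≤ CH^l`): hypothesis (i) of Shiu's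
theorem for the family `gH` (uniformly in `D`). [cite: Shiu1980, Theorem 1] -/
theorem gH_prime_pow_le_pow (D : ℕ) {p l : ℕ} (hp : p.Prime) (hl : 1 ≤ l) :
    gH c' D (p ^ l) ≤ (16 * CH) ^ l := by
  have hC := one_le_CH
  have h1 : ((l : ℝ) + 1) ^ 4 ≤ ((2 : ℝ) ^ 4) ^ l :=
    Literature.NumberTheory.Sieve.succ_pow_le_two_pow_pow 4 l
  have h2 : CH ≤ CH ^ l := le_self_pow₀ hC (by omega)
  calc gH c' D (p ^ l) ≤ CH * ((l : ℝ) + 1) ^ 4 := gH_prime_pow_le c' D hp l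
    _ ≤ CH ^ l * ((2 : ℝ) ^ 4) ^ l :=
        mul_le_mul h2 h1 (by positivity) (le_trans (by linarith) h2)
    _ = (16 * CH) ^ l := by rw [mul_pow]; norm_num; ring

omit c' D in
/-- Numerical bookkeeping: for `ℓ ≥ 3`, `0 ≤ B ≤ 9πℓ⁻⁹` and `0 ≤ L ≤ ℓ⁹ + 2`: `B·L ≤ 10π`.
[cite: Zhang2022LandauSiegel, §2 (2.13)] -/
theorem shift_mul_log_le {B ℓ L : ℝ} (hℓ : 3 ≤ ℓ) (hB : B ≤ 9 * π / ℓ ^ 9) (hL0 : 0 ≤ L)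
    (hL : L ≤ ℓ ^ 9 + 2) : B * L ≤ 10 * π := by
  have hℓ9 : (19683 : ℝ) ≤ ℓ ^ 9 := by
    calc (19683 : ℝ) = 3 ^ 9 := by norm_num
      _ ≤ ℓ ^ 9 := pow_le_pow_left₀ (by norm_num) hℓ 9
  have hl9pos : 0 < ℓ ^ 9 := by linarith
  have hπ := Real.pi_pos
  calc B * L ≤ 9 * π / ℓ ^ 9 * L := mul_le_mul_of_nonneg_right hB hL0
    _ ≤ 9 * π / ℓ ^ 9 * (ℓ ^ 9 + 2) := mul_le_mul_of_nonneg_left hL (by positivity)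
    _ = 9 * π + 18 * π / ℓ ^ 9 := by field_simp; ring
    _ ≤ 9 * π + 18 * π / 19683 := by
        have := div_le_div_of_nonneg_left (by positivity : 0 ≤ 18 * π) (by norm_num) hℓ9
        linarith
    _ ≤ 10 * π := by linarith

end Literature.NumberTheory.LFunctions.Zhang2022.XiZeroMajorant
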